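import Summits.ResolutionOfSingularities.ResolutionOfSingularities.Theorems.RadicialJungCleanModelsAbsoluteDifferentialsStructure
import Mathlib.RingTheory.Etale.Kaehler
import Mathlib.RingTheory.Localization.Free
import Mathlib.RingTheory.TensorProduct.IsBaseChangePi
import Mathlib.RingTheory.LocalProperties.Projective
import Mathlib.RingTheory.Localization.BaseChange
import Mathlib.RingTheory.LocalRing.Module
import HarnessLib

/-!
# Absolute differentials of a finite-type algebra over a field are free near a formally smooth point

Route `ResolutionOfSingularities/RadicialJung`, crux `CleanModels` (stmt-ResolutionOfSingularities-15917),
line `via-clean-models` of crux `DescentPerfectToAll` (stmt-ResolutionOfSingularities-0549): brick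
K3b of PROGRAMME-clean-dim2 (Giraud's normal form over an ARBITRARY ground field). Helper file
(`--supports`), OURS; nothing here is a statement of Hironaka's manuscript.

Companion of `RadicialJungCleanModelsAbsoluteDifferentialsStructure.lean` (`Ω[A⁄R] ≃ M₀ × (ι →₀ A)`
with `M₀` finitely presented, for `A` of finite type over a field `k` and any base `R → k`). Here:

* `exists_free_kaehler_localization_away` — **if `Ω[A_𝔭⁄R]` is projective at a prime `𝔭`** (e.g.
  `A_𝔭` formally smooth over `R`; for `R = 𝔽_p` this is every REGULAR point, by the tree's
  `formallySmooth_zmod_of_isRegularLocalRing_of_essFiniteType`, with no `F`-finiteness of `k`)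
  **then `Ω[A_r⁄R]` is a FREE `A_r`-module for some `r ∉ 𝔭`**: `(M₀)_𝔭` is a direct summand of
  `Ω[A_𝔭⁄R]`, hence projective, hence free (finite over a local ring), so `M₀` is free on a basic
  open neighbourhood (`Module.FinitePresentation.exists_free_localizedModule_powers`), and
  localisation commutes with `Ω` (`KaehlerDifferential.isLocalizedModule_map`) and with products.

This is the "`Ω¹_X` locally free" standing hypothesis of Giraud 1983 (1.1), recovered on the regular
locus of a `k`-scheme of finite type for ANY field `k` of characteristic `p` — of infinite rank when
`[k : k^p] = ∞`. With `RadicialJungCleanModelsCriticalLocusClosed.lean` it gives the closedness of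
Giraud's `E(f)`.

## References
* A. Grothendieck, EGA 0_IV (1964), 20.5.7. [EGA0IV]
* J. Giraud, *Forme normale d'une fonction sur une surface de caractéristique positive*, Bull. Soc.
  Math. France 111 (1983), 1.1. [Giraud1983]
-/

noncomputable section

set_option linter.dupNamespace false -- mandated namespace of this single-conjunct summit

open TensorProduct KaehlerDifferential Module

namespace Summit.ResolutionOfSingularities.ResolutionOfSingularities.Theorems.RadicialJung.CleanModels

universe u

/-! ## Local freeness of the absolute differentials near a formally smooth point -/

/-- **Local freeness.** For `A` of finite type over a field `k`, `R → k` a base ring and a prime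
`𝔭` of `A` at which `Ω[A_𝔭⁄R]` is a projective `A_𝔭`-module (e.g. `A_𝔭` formally smooth over `R`;
for `R = 𝔽_p`: every regular point, `formallySmooth_zmod_of_isRegularLocalRing_of_essFiniteType`),
there is `r ∉ 𝔭` with `Ω[A_r⁄R]` a FREE `A_r`-module. Proof: with `Ω[A⁄R] ≃ M₀ × (ι →₀ A)`
(`exists_linearEquiv_kaehler_prod_finsupp_of_finiteType`), `(M₀)_𝔭` is a direct summand of
`Ω[A_𝔭⁄R]`, hence projective, hence free (finite over a local ring), so `M₀` is free on a basic
open neighbourhood of `𝔭` (`Module.FinitePresentation.exists_free_localizedModule_powers`), and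
localisation commutes with `Ω` and with products. [cite: EGA0IV, Thm. 20.5.7] -/
theorem exists_free_kaehler_localization_away (R k A : Type u) [CommRing R] [Field k] [CommRing A]
    [Algebra R k] [Algebra R A] [Algebra k A] [IsScalarTower R k A] [Algebra.FiniteType k A]
    (P₀ : Ideal A) [P₀.IsPrime]
    [Module.Projective (Localization.AtPrime P₀) Ω[Localization.AtPrime P₀⁄R]] :
    ∃ r ∉ P₀, Module.Free (Localization.Away r) Ω[Localization.Away r⁄R] := by
  classical
  obtain ⟨M₀, _, _, _, ι, ⟨e⟩⟩ := exists_linearEquiv_kaehler_prod_finsupp_of_finiteType R k A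
  let L := Localization.AtPrime P₀
  let S := P₀.primeCompl
  let g₀ := LocalizedModule.mkLinearMap S M₀
  -- `(M₀)_𝔭` is a direct summand of `Ω[A_𝔭⁄R]`
  let i₀ : M₀ →ₗ[A] Ω[L⁄R] :=
    map R R A L ∘ₗ (e.symm : M₀ × (ι →₀ A) →ₗ[A] Ω[A⁄R]) ∘ₗ LinearMap.inl A M₀ (ι →₀ A)
  have hu₁ : ∀ x : S, IsUnit (algebraMap A (Module.End A Ω[L⁄R]) x) :=
    fun x => IsLocalizedModule.map_units (map R R A L) x
  have hu₂ : ∀ x : S, IsUnit (algebraMap A (Module.End A (LocalizedModule S M₀)) x) :=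
    fun x => IsLocalizedModule.map_units g₀ x
  let i : LocalizedModule S M₀ →ₗ[A] Ω[L⁄R] := IsLocalizedModule.lift S g₀ i₀ hu₁
  have hi : ∀ m, i (g₀ m) = i₀ m := fun m =>
    LinearMap.congr_fun (IsLocalizedModule.lift_comp S g₀ i₀ hu₁) m
  let r₀ : Ω[A⁄R] →ₗ[A] LocalizedModule S M₀ :=
    g₀ ∘ₗ LinearMap.fst A M₀ (ι →₀ A) ∘ₗ (e : Ω[A⁄R] →ₗ[A] M₀ × (ι →₀ A))
  let r : Ω[L⁄R] →ₗ[A] LocalizedModule S M₀ := IsLocalizedModule.lift S (map R R A L) r₀ hu₂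
  have hr : ∀ ω, r (map R R A L ω) = r₀ ω := fun ω =>
    LinearMap.congr_fun (IsLocalizedModule.lift_comp S (map R R A L) r₀ hu₂) ω
  have hri : r ∘ₗ i = LinearMap.id := by
    refine IsLocalizedModule.linearMap_ext S g₀ g₀ ?_
    ext m
    simp only [LinearMap.comp_apply, LinearMap.id_comp, hi, i₀, hr, r₀, LinearEquiv.coe_coe,
      LinearMap.inl_apply, LinearEquiv.apply_symm_apply, LinearMap.fst_apply]
  haveI : Module.Projective L (LocalizedModule S M₀) :=
    Module.Projective.of_split (i.extendScalarsOfIsLocalization S L)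
      (r.extendScalarsOfIsLocalization S L) (by
        ext x
        have := LinearMap.congr_fun hri x
        simpa using this)
  haveI : Module.Finite L (LocalizedModule S M₀) := Module.Finite.of_isLocalizedModule S (Rₚ := L) g₀
  haveI : Module.Free L (LocalizedModule S M₀) := Module.free_of_flat_of_isLocalRing
  obtain ⟨t, ht, hfree, -⟩ := Module.FinitePresentation.exists_free_localizedModule_powers S g₀ L
  refine ⟨t, fun h => ht h, ?_⟩
  -- localisation at `t` commutes with `Ω` and with the product decomposition
  haveI := hfree
  let At := Localization.Away t
  let St := Submonoid.powers t
  let gN : M₀ × (ι →₀ A) →ₗ[A] LocalizedModule.Away t M₀ × (ι →₀ At) :=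
    (LocalizedModule.mkLinearMap St M₀).prodMap
      (Finsupp.mapRange.linearMap (Algebra.linearMap A At))
  haveI : IsLocalizedModule St gN := IsLocalizedModule.prodMap St _ _
  haveI : IsLocalizedModule St (map R R A At ∘ₗ (e.symm : M₀ × (ι →₀ A) →ₗ[A] Ω[A⁄R])) :=
    IsLocalizedModule.of_linearEquiv_right St (map R R A At) e.symm
  let eN : (LocalizedModule.Away t M₀ × (ι →₀ At)) ≃ₗ[At] Ω[At⁄R] :=
    (IsLocalizedModule.linearEquiv St gN
      (map R R A At ∘ₗ (e.symm : M₀ × (ι →₀ A) →ₗ[A] Ω[A⁄R]))).extendScalarsOfIsLocalization St At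
  exact Module.Free.of_equiv eN

end Summit.ResolutionOfSingularities.ResolutionOfSingularities.Theorems.RadicialJung.CleanModels

end
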